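import Mathlib
import Literature.AlgebraicGeometry.Resolution.AffineBlowupIntegral
import Summits.ResolutionOfSingularities.ResolutionOfSingularities.Theorems.WildQuotientsWildQuotientResolutionTwoBlocksCentreStable
import Summits.ResolutionOfSingularities.ResolutionOfSingularities.Theorems.WildQuotientsWildQuotientResolutionZ9PeeledWeightIdeals

/-!
# ℤ9 SPECIMEN (peeled `𝔸⁴/ℤ9`, char 3), brick Z2 part 2: the `(7,4,1 | 0)`-weight ideal `I₂₈` is `⟨σ̄⟩`-stable
(crux stmt-ResolutionOfSingularities-15640 `WildQuotients.WildQuotientResolution`, line `Sketch`; S1 =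
stmt-ResolutionOfSingularities-17941 `CyclicQuotientFourfolds`, non-linear sector; chain w45c card P specimen
«peeled 𝔸⁴/ℤ9» — res-L1-w45c-idea-2 memo `L/res-L1-w45c-idea-2/cardP_g12/Z9-SPECIMEN.md` §1/§4 (brick Z2),
res-L1-w45c-plan-1 GO 2026-08-27T16:29:20Z (variant V-BR) + CLARIFICATION 16:29:52Z (letter defaults, table
form of the generator vector, «033 = Z2 NOW»); method = res-L1-w45c-stub-4's V4U weight-ideal argument
`JordanFour.I6Stable` / `I6StableJ4` transposed from `(3,2,1)` to `(7,4,1)`. [OURS · L1 W4.5c] — NOT a statement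
of any manuscript; replaces the role of no printed item; AI-produced, weaker than expert review. Def-free.
Prover res-D-pv-033.)

SETTING (letters of record, plan-1 16:29:52Z (2)). `σ̄` on `k[x₁,…,xₙ]`: `σ̄ x_a = x_a`, `σ̄ x_b = x_b + x_a`,
`σ̄ x_c = x_c + x_b`, `σ̄ x_d = x_d + x_c³ − x_a² x_c` (the peel coordinate `w = x_d`), passengers fixed — the
order-`3` automorphism of `Y₁ = 𝔸⁴/σ³ = 𝔸⁴` induced by `J₄` in characteristic `3` (memo §0). Card P's minimal
vertex `w* = (7,4,1 | 0)` gives the weighted centre; as an IDEAL blow-up the tree can type it is `Bl_{I₂₈} Y₁` with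
`I₂₈ = W₂₈`, the monomial ideal of `(7,4,1)`-weight `≥ 28` in `(x_a, x_b, x_c)` (`x_d` has weight `0` and never
enters). Throughout, the WEIGHT IDEALS are written literally,
`W_w = Ideal.span {x | ∃ i j l, w ≤ 7i + 4j + l ∧ x = x_a^i x_b^j x_c^l}`, and the 24 minimal generators of `I₂₈`
(memo §1) enter only through an ABSTRACT vector `g : Fin 24 → k[x]` with the exponent TABLE
`![(4, 0, 0), (3, 2, 0), (3, 1, 3), (3, 0, 7), (2, 4, 0), (2, 3, 2), (2, 2, 6), (2, 1, 10), (2, 0, 14), (1, 6, 0), (1, 5, 1), (1, 4, 5), (1, 3, 9), (1, 2, 13), (1, 1, 17), (1, 0, 21), (0, 7, 0), (0, 6, 4), (0, 5, 8), (0, 4, 12), (0, 3, 16), (0, 2, 20), (0, 1, 24), (0, 0, 28)]`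
(`hg : ∀ q, g q = x_a^(e q).1 x_b^(e q).2.1 x_c^(e q).2.2`; `JordanFour.I6Abstract` mould — the literal vector would make
the Rees arithmetic of Z3 unusable).

(Part 1, `…Z9PeeledWeightIdeals`: the weight-ideal calculus `span_weight_*`, `map_span_weight_le/_eq`.)
* **`span_range_eq_span_weight`** — `Ideal.span (Set.range g) = W₂₈` for the abstract generator vector (24-leaf
  case split: every monomial of weight `≥ 28` is a multiple of a tabulated generator);
* `map_I28_eq`, **`smul_I28_pointwise`** (`g • I₂₈ = I₂₈` on `⟨σ̄⟩`), **`idealSheaf_I28_comap`** (VERBATIM the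
  hypothesis `hJ` of `IsBlowup.liftAction` for `Bl_{I₂₈} 𝔸ⁿ` and any `ρ` with the affine-quotient law),
  `I28_ne_bot`, `I28_blowup_integral_proper_birational`.
-/

-- single-problem summit: the doubled namespace component `ResolutionOfSingularities` is forced
set_option linter.dupNamespace false

noncomputable section

open CategoryTheory AlgebraicGeometry MvPolynomial
open scoped Pointwise
open Literature.AlgebraicGeometry.Resolution

namespace Summit.ResolutionOfSingularities.ResolutionOfSingularities.Theorems.WildQuotientResolution.Z9Peeled

/-! ## The 24 tabulated generators span `W₂₈` -/

section Generators

variable (k : Type) [Field k] (n : ℕ) (a b c : Fin n)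

/-- The exponent table of the 24 minimal generators of `I₂₈` (memo §1 order; local shorthand, unfolds at
elaboration). -/
local notation3 "e24" => (![(4, 0, 0), (3, 2, 0), (3, 1, 3), (3, 0, 7), (2, 4, 0), (2, 3, 2), (2, 2, 6), (2, 1, 10), (2, 0, 14), (1, 6, 0), (1, 5, 1), (1, 4, 5), (1, 3, 9), (1, 2, 13), (1, 1, 17), (1, 0, 21), (0, 7, 0), (0, 6, 4), (0, 5, 8), (0, 4, 12), (0, 3, 16), (0, 2, 20), (0, 1, 24), (0, 0, 28)] : Fin 24 → ℕ × ℕ × ℕ)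

/-- Every tabulated generator has `(7,4,1)`-weight at least `28`. [folklore] -/
theorem weight_e24_ge (q : Fin 24) : 28 ≤ 7 * (e24 q).1 + 4 * (e24 q).2.1 + (e24 q).2.2 := by
  fin_cases q <;> decide

/-- **The tabulated generators span exactly `W₂₈`**: for every vector `g` realising the exponent table,
`Ideal.span (Set.range g) = W₂₈` (every monomial `x_a^i x_b^j x_c^l` of weight `7i + 4j + l ≥ 28` is a
multiple of a tabulated one — 24-leaf case split on `(i, j)`). [folklore] -/
theorem span_range_eq_span_weight (g : Fin 24 → MvPolynomial (Fin n) k)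
    (hg : ∀ q, g q = X a ^ (e24 q).1 * X b ^ (e24 q).2.1 * X c ^ (e24 q).2.2) :
    Ideal.span (Set.range g) =
      Ideal.span {x : MvPolynomial (Fin n) k | ∃ i j l : ℕ, 28 ≤ 7 * i + 4 * j + l ∧
        x = X a ^ i * X b ^ j * X c ^ l} := by
  apply le_antisymm
  · rw [Ideal.span_le]
    rintro _ ⟨q, rfl⟩
    rw [hg q]
    exact Ideal.subset_span ⟨_, _, _, weight_e24_ge q, rfl⟩
  · refine Ideal.span_le.2 ?_
    rintro _ ⟨i, j, l, hw, rfl⟩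
    have hgen : ∀ (q : Fin 24) (rest : MvPolynomial (Fin n) k), g q * rest ∈ Ideal.span (Set.range g) :=
      fun q rest => Ideal.mul_mem_right _ _ (Ideal.subset_span ⟨q, rfl⟩)
    have hg0 : g 0 = X a ^ 4 * X b ^ 0 * X c ^ 0 := hg 0
    have hg1 : g 1 = X a ^ 3 * X b ^ 2 * X c ^ 0 := hg 1
    have hg2 : g 2 = X a ^ 3 * X b ^ 1 * X c ^ 3 := hg 2
    have hg3 : g 3 = X a ^ 3 * X b ^ 0 * X c ^ 7 := hg 3
    have hg4 : g 4 = X a ^ 2 * X b ^ 4 * X c ^ 0 := hg 4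
    have hg5 : g 5 = X a ^ 2 * X b ^ 3 * X c ^ 2 := hg 5
    have hg6 : g 6 = X a ^ 2 * X b ^ 2 * X c ^ 6 := hg 6
    have hg7 : g 7 = X a ^ 2 * X b ^ 1 * X c ^ 10 := hg 7
    have hg8 : g 8 = X a ^ 2 * X b ^ 0 * X c ^ 14 := hg 8
    have hg9 : g 9 = X a ^ 1 * X b ^ 6 * X c ^ 0 := hg 9
    have hg10 : g 10 = X a ^ 1 * X b ^ 5 * X c ^ 1 := hg 10
    have hg11 : g 11 = X a ^ 1 * X b ^ 4 * X c ^ 5 := hg 11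
    have hg12 : g 12 = X a ^ 1 * X b ^ 3 * X c ^ 9 := hg 12
    have hg13 : g 13 = X a ^ 1 * X b ^ 2 * X c ^ 13 := hg 13
    have hg14 : g 14 = X a ^ 1 * X b ^ 1 * X c ^ 17 := hg 14
    have hg15 : g 15 = X a ^ 1 * X b ^ 0 * X c ^ 21 := hg 15
    have hg16 : g 16 = X a ^ 0 * X b ^ 7 * X c ^ 0 := hg 16
    have hg17 : g 17 = X a ^ 0 * X b ^ 6 * X c ^ 4 := hg 17
    have hg18 : g 18 = X a ^ 0 * X b ^ 5 * X c ^ 8 := hg 18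
    have hg19 : g 19 = X a ^ 0 * X b ^ 4 * X c ^ 12 := hg 19
    have hg20 : g 20 = X a ^ 0 * X b ^ 3 * X c ^ 16 := hg 20
    have hg21 : g 21 = X a ^ 0 * X b ^ 2 * X c ^ 20 := hg 21
    have hg22 : g 22 = X a ^ 0 * X b ^ 1 * X c ^ 24 := hg 22
    have hg23 : g 23 = X a ^ 0 * X b ^ 0 * X c ^ 28 := hg 23
    change X a ^ i * X b ^ j * X c ^ l ∈ Ideal.span (Set.range g)
    rcases Nat.lt_or_ge i 4 with hi | hi
    · interval_cases i
      · -- `i = 0`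
        rcases Nat.lt_or_ge j 7 with hj | hj
        · interval_cases j
          · obtain ⟨l', rfl⟩ := Nat.exists_eq_add_of_le (by omega : 28 ≤ l)
            have e : (X a ^ 0 * X b ^ 0 * X c ^ (28 + l') : MvPolynomial (Fin n) k) =
                g 23 * X c ^ l' := by rw [hg23]; ring
            rw [e]; exact hgen 23 _
          · obtain ⟨l', rfl⟩ := Nat.exists_eq_add_of_le (by omega : 24 ≤ l)
            have e : (X a ^ 0 * X b ^ 1 * X c ^ (24 + l') : MvPolynomial (Fin n) k) =
                g 22 * X c ^ l' := by rw [hg22]; ring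
            rw [e]; exact hgen 22 _
          · obtain ⟨l', rfl⟩ := Nat.exists_eq_add_of_le (by omega : 20 ≤ l)
            have e : (X a ^ 0 * X b ^ 2 * X c ^ (20 + l') : MvPolynomial (Fin n) k) =
                g 21 * X c ^ l' := by rw [hg21]; ring
            rw [e]; exact hgen 21 _
          · obtain ⟨l', rfl⟩ := Nat.exists_eq_add_of_le (by omega : 16 ≤ l)
            have e : (X a ^ 0 * X b ^ 3 * X c ^ (16 + l') : MvPolynomial (Fin n) k) =
                g 20 * X c ^ l' := by rw [hg20]; ring
            rw [e]; exact hgen 20 _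
          · obtain ⟨l', rfl⟩ := Nat.exists_eq_add_of_le (by omega : 12 ≤ l)
            have e : (X a ^ 0 * X b ^ 4 * X c ^ (12 + l') : MvPolynomial (Fin n) k) =
                g 19 * X c ^ l' := by rw [hg19]; ring
            rw [e]; exact hgen 19 _
          · obtain ⟨l', rfl⟩ := Nat.exists_eq_add_of_le (by omega : 8 ≤ l)
            have e : (X a ^ 0 * X b ^ 5 * X c ^ (8 + l') : MvPolynomial (Fin n) k) =
                g 18 * X c ^ l' := by rw [hg18]; ring
            rw [e]; exact hgen 18 _
          · obtain ⟨l', rfl⟩ := Nat.exists_eq_add_of_le (by omega : 4 ≤ l)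
            have e : (X a ^ 0 * X b ^ 6 * X c ^ (4 + l') : MvPolynomial (Fin n) k) =
                g 17 * X c ^ l' := by rw [hg17]; ring
            rw [e]; exact hgen 17 _
        · obtain ⟨j', rfl⟩ := Nat.exists_eq_add_of_le hj
          have e : (X a ^ 0 * X b ^ (7 + j') * X c ^ l : MvPolynomial (Fin n) k) =
              g 16 * (X b ^ j' * X c ^ l) := by rw [hg16]; ring
          rw [e]; exact hgen 16 _
      · -- `i = 1`
        rcases Nat.lt_or_ge j 6 with hj | hj
        · interval_cases j
          · obtain ⟨l', rfl⟩ := Nat.exists_eq_add_of_le (by omega : 21 ≤ l)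
            have e : (X a ^ 1 * X b ^ 0 * X c ^ (21 + l') : MvPolynomial (Fin n) k) =
                g 15 * X c ^ l' := by rw [hg15]; ring
            rw [e]; exact hgen 15 _
          · obtain ⟨l', rfl⟩ := Nat.exists_eq_add_of_le (by omega : 17 ≤ l)
            have e : (X a ^ 1 * X b ^ 1 * X c ^ (17 + l') : MvPolynomial (Fin n) k) =
                g 14 * X c ^ l' := by rw [hg14]; ring
            rw [e]; exact hgen 14 _
          · obtain ⟨l', rfl⟩ := Nat.exists_eq_add_of_le (by omega : 13 ≤ l)
            have e : (X a ^ 1 * X b ^ 2 * X c ^ (13 + l') : MvPolynomial (Fin n) k) =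
                g 13 * X c ^ l' := by rw [hg13]; ring
            rw [e]; exact hgen 13 _
          · obtain ⟨l', rfl⟩ := Nat.exists_eq_add_of_le (by omega : 9 ≤ l)
            have e : (X a ^ 1 * X b ^ 3 * X c ^ (9 + l') : MvPolynomial (Fin n) k) =
                g 12 * X c ^ l' := by rw [hg12]; ring
            rw [e]; exact hgen 12 _
          · obtain ⟨l', rfl⟩ := Nat.exists_eq_add_of_le (by omega : 5 ≤ l)
            have e : (X a ^ 1 * X b ^ 4 * X c ^ (5 + l') : MvPolynomial (Fin n) k) =
                g 11 * X c ^ l' := by rw [hg11]; ring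
            rw [e]; exact hgen 11 _
          · obtain ⟨l', rfl⟩ := Nat.exists_eq_add_of_le (by omega : 1 ≤ l)
            have e : (X a ^ 1 * X b ^ 5 * X c ^ (1 + l') : MvPolynomial (Fin n) k) =
                g 10 * X c ^ l' := by rw [hg10]; ring
            rw [e]; exact hgen 10 _
        · obtain ⟨j', rfl⟩ := Nat.exists_eq_add_of_le hj
          have e : (X a ^ 1 * X b ^ (6 + j') * X c ^ l : MvPolynomial (Fin n) k) =
              g 9 * (X b ^ j' * X c ^ l) := by rw [hg9]; ring
          rw [e]; exact hgen 9 _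
      · -- `i = 2`
        rcases Nat.lt_or_ge j 4 with hj | hj
        · interval_cases j
          · obtain ⟨l', rfl⟩ := Nat.exists_eq_add_of_le (by omega : 14 ≤ l)
            have e : (X a ^ 2 * X b ^ 0 * X c ^ (14 + l') : MvPolynomial (Fin n) k) =
                g 8 * X c ^ l' := by rw [hg8]; ring
            rw [e]; exact hgen 8 _
          · obtain ⟨l', rfl⟩ := Nat.exists_eq_add_of_le (by omega : 10 ≤ l)
            have e : (X a ^ 2 * X b ^ 1 * X c ^ (10 + l') : MvPolynomial (Fin n) k) =
                g 7 * X c ^ l' := by rw [hg7]; ring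
            rw [e]; exact hgen 7 _
          · obtain ⟨l', rfl⟩ := Nat.exists_eq_add_of_le (by omega : 6 ≤ l)
            have e : (X a ^ 2 * X b ^ 2 * X c ^ (6 + l') : MvPolynomial (Fin n) k) =
                g 6 * X c ^ l' := by rw [hg6]; ring
            rw [e]; exact hgen 6 _
          · obtain ⟨l', rfl⟩ := Nat.exists_eq_add_of_le (by omega : 2 ≤ l)
            have e : (X a ^ 2 * X b ^ 3 * X c ^ (2 + l') : MvPolynomial (Fin n) k) =
                g 5 * X c ^ l' := by rw [hg5]; ring
            rw [e]; exact hgen 5 _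
        · obtain ⟨j', rfl⟩ := Nat.exists_eq_add_of_le hj
          have e : (X a ^ 2 * X b ^ (4 + j') * X c ^ l : MvPolynomial (Fin n) k) =
              g 4 * (X b ^ j' * X c ^ l) := by rw [hg4]; ring
          rw [e]; exact hgen 4 _
      · -- `i = 3`
        rcases Nat.lt_or_ge j 2 with hj | hj
        · interval_cases j
          · obtain ⟨l', rfl⟩ := Nat.exists_eq_add_of_le (by omega : 7 ≤ l)
            have e : (X a ^ 3 * X b ^ 0 * X c ^ (7 + l') : MvPolynomial (Fin n) k) =
                g 3 * X c ^ l' := by rw [hg3]; ring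
            rw [e]; exact hgen 3 _
          · obtain ⟨l', rfl⟩ := Nat.exists_eq_add_of_le (by omega : 3 ≤ l)
            have e : (X a ^ 3 * X b ^ 1 * X c ^ (3 + l') : MvPolynomial (Fin n) k) =
                g 2 * X c ^ l' := by rw [hg2]; ring
            rw [e]; exact hgen 2 _
        · obtain ⟨j', rfl⟩ := Nat.exists_eq_add_of_le hj
          have e : (X a ^ 3 * X b ^ (2 + j') * X c ^ l : MvPolynomial (Fin n) k) =
              g 1 * (X b ^ j' * X c ^ l) := by rw [hg1]; ring
          rw [e]; exact hgen 1 _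
    · obtain ⟨i', rfl⟩ := Nat.exists_eq_add_of_le hi
      have e : (X a ^ (4 + i') * X b ^ j * X c ^ l : MvPolynomial (Fin n) k) =
          g 0 * (X a ^ i' * X b ^ j * X c ^ l) := by rw [hg0]; ring
      rw [e]; exact hgen 0 _

variable (σ : MvPolynomial (Fin n) k ≃ₐ[k] MvPolynomial (Fin n) k) (d : Fin n)
  (hab : a ≠ b) (hac : a ≠ c) (had : a ≠ d)
  (h0 : σ (X a) = X a) (hb : σ (X b) = X b + X a) (hc : σ (X c) = X c + X b)

include h0 hb hc in
/-- **`σ̄(I₂₈) = I₂₈`** for the abstract generator vector (`span_range_eq_span_weight` + `map_span_weight_eq`;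
the laws of `σ̄` on `x_d` and on the passengers are not used). [folklore] -/
theorem map_I28_eq (g : Fin 24 → MvPolynomial (Fin n) k)
    (hg : ∀ q, g q = X a ^ (e24 q).1 * X b ^ (e24 q).2.1 * X c ^ (e24 q).2.2) :
    Ideal.map (σ : MvPolynomial (Fin n) k →+* MvPolynomial (Fin n) k) (Ideal.span (Set.range g)) =
      Ideal.span (Set.range g) := by
  rw [span_range_eq_span_weight k n a b c g hg]
  exact map_span_weight_eq k n a b c σ h0 hb hc 28

include h0 hb hc in
/-- **`I₂₈` is `⟨σ̄⟩`-stable**: `g • I₂₈ = I₂₈` for every `g ∈ ⟨σ̄⟩`, in EVERY characteristic — the hypothesis of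
`AffineQuotient.idealSheaf_comap_specAction` / `IsBlowup.liftAction` for the weighted blow-up `Bl_{I₂₈} Y₁`
(mould `JordanFour.smul_I6_eq`). [folklore] -/
theorem smul_I28_pointwise (g : Fin 24 → MvPolynomial (Fin n) k)
    (hg : ∀ q, g q = X a ^ (e24 q).1 * X b ^ (e24 q).2.1 * X c ^ (e24 q).2.2) (γ : Subgroup.zpowers σ) :
    γ • Ideal.span (Set.range g) = Ideal.span (Set.range g) := by
  have hσ' : σ • Ideal.span (Set.range g) = Ideal.span (Set.range g) := map_I28_eq k n a b c σ h0 hb hc g hg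
  obtain ⟨z, hz⟩ := Subgroup.mem_zpowers_iff.mp γ.2
  change (γ : MvPolynomial (Fin n) k ≃ₐ[k] MvPolynomial (Fin n) k) • Ideal.span (Set.range g) = _
  rw [← hz]
  exact MulAction.fixedBy_subset_fixedBy_zpow (Ideal (MvPolynomial (Fin n) k)) σ z hσ'

include h0 hb hc in
/-- **The ideal sheaf of `I₂₈` on `𝔸ⁿ = Spec k[x]` is stable under every action of `⟨σ̄⟩` with the
affine-quotient law `ρ γ = Spec (γ⁻¹)`** — VERBATIM the hypothesis `hJ` of `IsBlowup.liftAction` for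
`Bl_{I₂₈} 𝔸ⁿ` (mould `JordanFour.idealSheaf_I6_comap`). [folklore] -/
theorem idealSheaf_I28_comap (g : Fin 24 → MvPolynomial (Fin n) k)
    (hg : ∀ q, g q = X a ^ (e24 q).1 * X b ^ (e24 q).2.1 * X c ^ (e24 q).2.2)
    (ρ : ↥(Subgroup.zpowers σ) →* Aut (Spec (CommRingCat.of (MvPolynomial (Fin n) k))))
    (hρ : ∀ γ : ↥(Subgroup.zpowers σ), (ρ γ).hom = Spec.map (CommRingCat.ofHom
      ((MulSemiringAction.toRingEquiv (↥(Subgroup.zpowers σ)) (MvPolynomial (Fin n) k) γ⁻¹ :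
        MvPolynomial (Fin n) k ≃+* MvPolynomial (Fin n) k) :
          MvPolynomial (Fin n) k →+* MvPolynomial (Fin n) k)))
    (γ : ↥(Subgroup.zpowers σ)) :
    (affineBlowup.idealSheaf (Ideal.span (Set.range g))).comap (ρ γ).hom =
      affineBlowup.idealSheaf (Ideal.span (Set.range g)) :=
  AffineQuotient.idealSheaf_comap_specAction ρ hρ _ (smul_I28_pointwise k n a b c σ h0 hb hc g hg) γ

/-- `I₂₈ ≠ 0` (`x_a⁴ = g 0 ∈ I₂₈`). [folklore] -/
theorem I28_ne_bot (g : Fin 24 → MvPolynomial (Fin n) k)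
    (hg : ∀ q, g q = X a ^ (e24 q).1 * X b ^ (e24 q).2.1 * X c ^ (e24 q).2.2) :
    Ideal.span (Set.range g) ≠ ⊥ := by
  intro h
  rw [Ideal.span_eq_bot] at h
  have h0 : g 0 = 0 := h _ ⟨0, rfl⟩
  have hg0 : g 0 = X a ^ 4 * X b ^ 0 * X c ^ 0 := hg 0
  rw [hg0, pow_zero, pow_zero, mul_one, mul_one] at h0
  exact pow_ne_zero 4 (X_ne_zero a) h0

/-- **`Bl_{I₂₈} 𝔸ⁿ` is integral, and proper and birational over `𝔸ⁿ`** (mould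
`JordanFour.I6_blowup_integral_proper_birational`). [OURS · L1 W4.5c] -/
theorem I28_blowup_integral_proper_birational (g : Fin 24 → MvPolynomial (Fin n) k)
    (hg : ∀ q, g q = X a ^ (e24 q).1 * X b ^ (e24 q).2.1 * X c ^ (e24 q).2.2) :
    IsIntegral (affineBlowup (Ideal.span (Set.range g))) ∧
      IsProper (affineBlowup.π (Ideal.span (Set.range g))) ∧
      IsBirational (affineBlowup.π (Ideal.span (Set.range g))) :=
  ⟨affineBlowup.isIntegral (I28_ne_bot k n a b c g hg), inferInstance,
    affineBlowup.isBirational (I28_ne_bot k n a b c g hg)⟩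

end Generators

end Summit.ResolutionOfSingularities.ResolutionOfSingularities.Theorems.WildQuotientResolution.Z9Peeled

end
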